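import Summits.ValiantsHypothesis.ValiantsHypothesis.Theorems.BarrierLeverPartitionMinorsGenericChowProduct

/-!
# Route BarrierLever — Chow witnesses for partition minors (items 20172 / 20195): the ROW/COLUMN SWAP

Helper file (`--supports stmt-ValiantsHypothesis-20195`; cell valiant-natproofs, rung V4, 𝒟-side of
door (c); seat val-np-p4 gen 10).  Closes NO item; imports only `…PartitionMinorsGenericChowProduct`.

`chow_hit_swap` — if the layout `(w, u)` is hit by a product of `h + h` affine forms, so is `(u, w)`:
exchange the `x`- and `y`-variables (`x_a ↔ y_a`, the literal flip of the transversal world,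
`FiniteCheck.tt_layout_swap`); a product of affine forms stays one, the partition matrix is
transposed.  Halves every certificate table for finite slices of CPM (e.g. the 224 locked pairs at
height 3, HOME/val-np-p4/CHOW-ENGINE-MEMO-g10.md).

WHAT THIS IS NOT: a symmetry; nothing on items 20172 / 20195 / 19717 themselves, on crux
stmt-ValiantsHypothesis-14610, or on `VP` versus `VNP`.
-/

set_option linter.dupNamespace false

namespace Summit.ValiantsHypothesis.ValiantsHypothesis.Theorems.BarrierLever.ChowFactor

open Finset MvPolynomial

noncomputable section

variable {h : ℕ}

/-- The variable flip `x_a ↔ y_a` on an `x`-variable. -/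
theorem flip_castAdd (a : Fin h) :
    (finSumFinEquiv.symm.trans ((Equiv.sumComm (Fin h) (Fin h)).trans finSumFinEquiv))
      (Fin.castAdd h a) = Fin.natAdd h a := by
  simp only [Equiv.trans_apply, finSumFinEquiv_symm_apply_castAdd, Equiv.sumComm_apply,
    Sum.swap_inl, finSumFinEquiv_apply_right]

/-- The variable flip on a `y`-variable. -/
theorem flip_natAdd (c : Fin h) :
    (finSumFinEquiv.symm.trans ((Equiv.sumComm (Fin h) (Fin h)).trans finSumFinEquiv))
      (Fin.natAdd h c) = Fin.castAdd h c := by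
  simp only [Equiv.trans_apply, finSumFinEquiv_symm_apply_natAdd, Equiv.sumComm_apply,
    Sum.swap_inr, finSumFinEquiv_apply_left]

/-- The flip exchanges the two halves of the partition exponent. -/
theorem mapDomain_flip_partitionExpo (u w : Finset (Fin h)) :
    Finsupp.mapDomain (finSumFinEquiv.symm.trans ((Equiv.sumComm (Fin h) (Fin h)).trans finSumFinEquiv))
      (∑ b ∈ w, Finsupp.single (Fin.castAdd h b) 1 + ∑ d ∈ u, Finsupp.single (Fin.natAdd h d) 1 :
        Fin (h + h) →₀ ℕ) =
      ∑ b ∈ u, Finsupp.single (Fin.castAdd h b) 1 + ∑ d ∈ w, Finsupp.single (Fin.natAdd h d) 1 := by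
  have hc : ∀ A B : Fin (h + h) →₀ ℕ, A + B = B + A := fun A B => add_comm A B
  rw [Finsupp.mapDomain_add, Finsupp.mapDomain_finsetSum, Finsupp.mapDomain_finsetSum, hc]
  congr 1
  · refine Finset.sum_congr rfl fun d _ => ?_
    rw [Finsupp.mapDomain_single, flip_natAdd]
  · refine Finset.sum_congr rfl fun b _ => ?_
    rw [Finsupp.mapDomain_single, flip_castAdd]

/-- **Row/column swap for Chow witnesses.** -/
theorem chow_hit_swap {r : ℕ} (u w : Fin r → Finset (Fin h))
    (hhit : ∃ ℓ : Fin (h + h) → MvPolynomial (Fin (h + h)) ℂ, (∀ q, (ℓ q).totalDegree ≤ 1) ∧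
      (Matrix.of fun i j : Fin r => coeff
        (∑ b ∈ w i, Finsupp.single (Fin.castAdd h b) 1 + ∑ d ∈ u j, Finsupp.single (Fin.natAdd h d) 1)
        (∏ q, ℓ q)).det ≠ 0) :
    ∃ ℓ : Fin (h + h) → MvPolynomial (Fin (h + h)) ℂ, (∀ q, (ℓ q).totalDegree ≤ 1) ∧
      (Matrix.of fun i j : Fin r => coeff
        (∑ b ∈ u i, Finsupp.single (Fin.castAdd h b) 1 + ∑ d ∈ w j, Finsupp.single (Fin.natAdd h d) 1)
        (∏ q, ℓ q)).det ≠ 0 := by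
  classical
  obtain ⟨ℓ, hdeg, hdet⟩ := hhit
  set φ : Fin (h + h) ≃ Fin (h + h) :=
    finSumFinEquiv.symm.trans ((Equiv.sumComm (Fin h) (Fin h)).trans finSumFinEquiv) with hφ
  refine ⟨fun q => rename φ (ℓ q), fun q => (totalDegree_rename_le _ _).trans (hdeg q), ?_⟩
  have hprod : (∏ q, rename φ (ℓ q)) = rename φ (∏ q, ℓ q) := by rw [map_prod]
  have hM : (Matrix.of fun i j : Fin r => coeff
      (∑ b ∈ u i, Finsupp.single (Fin.castAdd h b) 1 + ∑ d ∈ w j, Finsupp.single (Fin.natAdd h d) 1)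
      (∏ q, rename φ (ℓ q))) =
      (Matrix.of fun i j : Fin r => coeff
        (∑ b ∈ w i, Finsupp.single (Fin.castAdd h b) 1 + ∑ d ∈ u j, Finsupp.single (Fin.natAdd h d) 1)
        (∏ q, ℓ q)).transpose := by
    ext i j
    rw [Matrix.of_apply, Matrix.transpose_apply, Matrix.of_apply, hprod,
      ← mapDomain_flip_partitionExpo (u i) (w j), coeff_rename_mapDomain _ φ.injective]
  rw [hM, Matrix.det_transpose]
  exact hdet

end

end Summit.ValiantsHypothesis.ValiantsHypothesis.Theorems.BarrierLever.ChowFactor
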